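import Mathlib
import Summits.KontsevichZagierPeriods.Zeta5Search.TypeSpaceLawZeroProof
import Summits.KontsevichZagierPeriods.Zeta5Search.ResidueIdentityBProof
import Summits.KontsevichZagierPeriods.Zeta5Search.GHatMomentsProof
import Summits.KontsevichZagierPeriods.Zeta5Search.BigPrimeMinors
import HarnessLib

/-!
# ζ(5) search — `ResidueLaw.TypeSpaceLawZero` IS A THEOREM: the reduction bridge `ĝ_x ↦ ḡ_x`, `ĝ_xφ_x ↦ ḡ_xφ̄_x` and the glue

HONEST FRAMING: systematic search; no irrationality claim unless certified.

Cell `pub-zeta5`, prover seat p3 (gen 2).  typer g11 landed the zero-regime TYPE-SPACE LAW in conditional form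
(`SecondOrder.typeSpaceLawZero_of_residues`, `TypeSpaceLawZeroProof.lean` p238783): the class hypotheses of
`ResidueLaw.TypeSpaceLawZero` plus the two RATIONAL residue congruences `‖Res₀(b)‖ ≤ p⁻¹`, `‖Res₀(b+e_j)‖ ≤ p⁻¹`
(`Res₀(c) = Σ_{pole, E=−M} ĝφ + Σ_{pole, E=−M+1} ĝ`) give `v_p(Cas_j(b)) ≥ 6 − 2M`.  This file supplies the two congruences from
gen-2 g11's THEOREM R in the finite field (`residueIdentityB_holds`, p238276) and closes the statement BY NAME (`typeSpaceLawZero_holds`):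
* §1 reindexing `range p ↔ ZMod p` and the images of the class invariants in `ZMod p`: `gBar b p x = (ĝ_x mod p)` (from typer g10's
  `ClusterValuation.cast_gHat`) and `(φ_x mod p) = Σ_{w ≠ x̄} classExp(w)·(w − x̄)⁻¹ = phiBar b p x` (`cast_phiHat`, the same grouping of the
  foreign factors by residue classes, with the odd-centre bracket going to the class of `b₀/2`);
* §2 `res0_padicNorm_le`: for any `c` on the polytope with pole classes of exponent `≥ −M` and `p(M−2) + Σ_x E_x(c) ≤ −2`, the rational
  residue sum `Res₀(c)` is `p`-integral with image `Σ_{E=−M} ḡφ̄ + Σ_{E=−M+1} ḡ = 0` (`residueIdentityB_holds`), i.e. `‖Res₀(c)‖ ≤ p⁻¹`;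
* §3 the glue: DEG `p(M−2) + Σ_x E_x(b) ≤ −4` gives the `−2` version for `b + e_j` because `Σ_x E_x = −(2d+5)` (`sum_classExp_val`) and
  `d(b+e_j) = d(b) − 1` (`dOf_shift`); `G1_shift` transports the exponent bound.
`p`-adic valuations of rational numbers; nothing here bears on irrationality.
-/

noncomputable section

open Finset

namespace Summit.KontsevichZagierPeriods.Zeta5Search.ResidueLaw

open Summit.KontsevichZagierPeriods.Zeta5Search.ClusterValuation
open Summit.KontsevichZagierPeriods.Zeta5Search.SecondOrder (gBar phiBar phiHat typeSpaceLawZero_of_residues G1_shift)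
open Summit.KontsevichZagierPeriods.Zeta5Search.CasoratianValuation (InPolytope shift casoratian)
open Summit.KontsevichZagierPeriods.Zeta5Search.WedgeDictionary (dOf)
open Summit.KontsevichZagierPeriods.Zeta5Search.BigPrime (shift_zero dOf_shift)

variable {p : ℕ} [hp : Fact p.Prime]

/-! ## §1 Reindexing and the class invariants in `ZMod p` -/

/-- `Σ_{x < p} f(x) = Σ_{w ∈ ZMod p} f(w.val)`. -/
theorem sum_range_eq_sum_univ_val {β : Type*} [AddCommMonoid β] (f : ℕ → β) :
    ∑ x ∈ range p, f x = ∑ w : ZMod p, f w.val := by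
  refine Finset.sum_nbij' (fun x : ℕ => (x : ZMod p)) (fun w => w.val) (fun _ _ => mem_univ _)
    (fun w _ => mem_range.2 (ZMod.val_lt w)) (fun x hx => ZMod.val_cast_of_lt (mem_range.1 hx))
    (fun w _ => ZMod.natCast_zmod_val w) (fun x hx => by rw [ZMod.val_cast_of_lt (mem_range.1 hx)])

/-- **`gBar` is `ĝ` modulo `p`**: for a residue `x < p`, `gBar b p x = (ĝ_x : ZMod p)` (typer g10's `cast_gHat`, reindexed). -/
theorem gBar_eq_cast_gHat (b : ℕ → ℤ) (hp5 : 5 ≤ p) {x : ℕ} (hx : x < p) :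
    gBar b p x = ((gHat b p x : ℚ) : ZMod p) := by
  classical
  rw [(cast_gHat b hp5 x).2]
  unfold gBar
  rw [Nat.mod_eq_of_lt hx, mul_assoc, ← Finset.prod_inv_distrib, ← Finset.prod_mul_distrib,
    Finset.prod_congr rfl (fun y _ => (zpow_eq_pow_mul_pow_inv (((y : ℕ) : ZMod p) - (x : ZMod p)) (classExp b p y)).symm)]
  have hcong : ∀ y ∈ (range p).erase x, (((y : ℕ) : ZMod p) - (x : ZMod p)) ^ classExp b p y
      = (fun w : ZMod p => (w - (x : ZMod p)) ^ classExp b p w.val) ((y : ℕ) : ZMod p) := by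
    intro y hy
    simp only [ZMod.val_cast_of_lt (mem_range.1 (mem_of_mem_erase hy))]
  rw [Finset.prod_congr rfl hcong]
  congr 1
  exact prod_range_erase_eq_prod_univ_erase (fun w : ZMod p => (w - (x : ZMod p)) ^ classExp b p w.val) hx

/-- **`φ_x` modulo `p`.**  `φ_x` is `p`-integral and its image in `ZMod p` is `Σ_{w ≠ x̄} classExp(w)·(w − x̄)⁻¹`
(the odd-centre bracket of `phiHat` lands in the class of `b₀/2`, whose class exponent carries the `+1`). -/
theorem cast_phiHat (b : ℕ → ℤ) (hp5 : 5 ≤ p) (x : ℕ) :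
    ¬ p ∣ (phiHat b p x).den ∧
    ((phiHat b p x : ℚ) : ZMod p)
      = ∑ w ∈ univ.erase (x : ZMod p), ((classExp b p w.val : ℤ) : ZMod p) * (w - x)⁻¹ := by
  classical
  set S := (range ((b 0).toNat + 1)).filter (fun s => s % p ≠ x % p) with hS
  have hfac : ∀ s ∈ S, ¬ (p : ℤ) ∣ ((s : ℤ) - x) := by
    intro s hs h
    exact (mem_filter.1 hs).2 (Nat.modEq_iff_dvd.2 h).symm
  have hsx : ∀ s : ℕ, ((s : ℚ) - x) = (((s : ℤ) - x : ℤ) : ℚ) := fun s => by push_cast; ring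
  have hterm : ∀ s ∈ S, (netExp b s : ℚ) / ((s : ℚ) - x)
      = (netExp b s : ℚ) * ((((s : ℤ) - x : ℤ) : ℚ) ^ (-1 : ℤ)) := by
    intro s _
    rw [hsx, zpow_neg_one, div_eq_mul_inv]
  have hden1 : ∀ s ∈ S, ¬ p ∣ ((netExp b s : ℚ) / ((s : ℚ) - x)).den := by
    intro s hs
    rw [hterm s hs]
    exact PInt.mul (PInt.intCast _) (PInt.zpow_int (hfac s hs) _)
  have hcast1 : ∀ s ∈ S, ((((netExp b s : ℚ) / ((s : ℚ) - x)) : ℚ) : ZMod p)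
      = ((netExp b s : ℤ) : ZMod p) * ((s : ZMod p) - x)⁻¹ := by
    intro s hs
    rw [hterm s hs, PInt.cast_mul (PInt.intCast _) (PInt.zpow_int (hfac s hs) _), Rat.cast_intCast,
      PInt.cast_zpow_int (hfac s hs), zpow_neg_one, Int.cast_sub, Int.cast_natCast, Int.cast_natCast]
  have hdenS : ¬ p ∣ (∑ s ∈ S, (netExp b s : ℚ) / ((s : ℚ) - x)).den := PInt.sum hden1
  have hcastS : ((∑ s ∈ S, (netExp b s : ℚ) / ((s : ℚ) - x) : ℚ) : ZMod p)
      = ∑ s ∈ S, ((netExp b s : ℤ) : ZMod p) * ((s : ZMod p) - x)⁻¹ := by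
    rw [PInt.cast_sum hden1]
    exact sum_congr rfl hcast1
  -- group the foreign positions by residue class
  have hmaps : ∀ s ∈ S, (s : ZMod p) ∈ univ.erase (x : ZMod p) := by
    intro s hs
    exact mem_erase.2 ⟨fun h => (mem_filter.1 hs).2 ((ZMod.natCast_eq_natCast_iff' s x p).1 h), mem_univ _⟩
  have hfib : ∑ s ∈ S, ((netExp b s : ℤ) : ZMod p) * ((s : ZMod p) - x)⁻¹
      = ∑ w ∈ univ.erase (x : ZMod p), ((∑ s ∈ classSet b p w.val, netExp b s : ℤ) : ZMod p) * (w - x)⁻¹ := by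
    rw [← sum_fiberwise_of_maps_to hmaps]
    refine sum_congr rfl fun w hw => ?_
    have hfilter : S.filter (fun s : ℕ => (s : ZMod p) = w) = classSet b p w.val := by
      rw [← filter_natCast_eq_classSet b w, hS, filter_filter]
      refine filter_congr fun s _ => ⟨fun h => h.2, fun h => ⟨fun hsx' => (mem_erase.1 hw).1 ?_, h⟩⟩
      rw [← h, (ZMod.natCast_eq_natCast_iff' s x p).2 hsx']
    rw [hfilter, Int.cast_sum, sum_mul]
    refine sum_congr rfl fun s hs => ?_
    rw [← filter_natCast_eq_classSet b w] at hs
    rw [(mem_filter.1 hs).2]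
  -- the centre bracket
  set c : ZMod p := ((b 0 : ℤ) : ZMod p) / 2 with hc
  have h2 : (2 : ZMod p) ≠ 0 := by
    intro h
    have h' : ((2 : ℕ) : ZMod p) = 0 := by exact_mod_cast h
    rw [ZMod.natCast_eq_zero_iff] at h'
    have := Nat.le_of_dvd two_pos h'
    omega
  have hcx : CentreIn b p x ↔ (x : ZMod p) = c := centreIn_iff_cast b hp5 x
  have hBden : ¬ p ∣ (if ¬ (2 : ℤ) ∣ b 0 ∧ ¬ CentreIn b p x then 1 / ((b 0 : ℚ) / 2 - x) else 0 : ℚ).den := by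
    split_ifs with h
    · have hB : ¬ (p : ℤ) ∣ (b 0 - 2 * x) := by
        intro hd
        refine h.2 ?_
        unfold CentreIn
        have h' := dvd_neg.2 hd
        rwa [neg_sub] at h'
      have hBq : ((b 0 : ℚ) - 2 * x) ≠ 0 := by
        have : (b 0 - 2 * x : ℤ) ≠ 0 := fun h0 => hB (by rw [h0]; exact dvd_zero _)
        exact_mod_cast this
      rw [show (1 : ℚ) / ((b 0 : ℚ) / 2 - x) = ((2 : ℤ) : ℚ) * (((b 0 - 2 * x : ℤ) : ℚ)) ^ (-1 : ℤ) by
        rw [zpow_neg_one]; push_cast; field_simp]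
      exact PInt.mul (PInt.intCast _) (PInt.zpow_int hB _)
    · exact PInt.zero
  have hBcast : ((if ¬ (2 : ℤ) ∣ b 0 ∧ ¬ CentreIn b p x then 1 / ((b 0 : ℚ) / 2 - x) else 0 : ℚ) : ZMod p)
      = ∑ w ∈ univ.erase (x : ZMod p),
          ((if ¬ (2 : ℤ) ∣ b 0 ∧ CentreIn b p w.val then (1 : ℤ) else 0 : ℤ) : ZMod p) * (w - x)⁻¹ := by
    have hcorr : ∀ w : ZMod p, (¬ (2 : ℤ) ∣ b 0 ∧ CentreIn b p w.val) ↔ (¬ (2 : ℤ) ∣ b 0 ∧ w = c) := by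
      intro w
      rw [centreIn_iff_cast b hp5, ZMod.natCast_zmod_val]
    by_cases hodd : ¬ (2 : ℤ) ∣ b 0
    · have hterm' : ∀ w ∈ univ.erase (x : ZMod p),
          ((if ¬ (2 : ℤ) ∣ b 0 ∧ CentreIn b p w.val then (1 : ℤ) else 0 : ℤ) : ZMod p) * (w - x)⁻¹
            = if w = c then (w - x)⁻¹ else 0 := by
        intro w _
        by_cases hw : w = c
        · rw [if_pos ((hcorr w).2 ⟨hodd, hw⟩), if_pos hw, Int.cast_one, one_mul]
        · rw [if_neg (fun h => hw ((hcorr w).1 h).2), if_neg hw, Int.cast_zero, zero_mul]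
      rw [sum_congr rfl hterm', Finset.sum_ite_eq' (univ.erase (x : ZMod p)) c (fun w => (w - (x : ZMod p))⁻¹)]
      by_cases hcen : CentreIn b p x
      · rw [if_neg (fun h => h.2 hcen), if_neg (by rw [mem_erase]; exact fun h => h.1 (hcx.1 hcen).symm),
          Rat.cast_zero]
      · have hne : c ≠ (x : ZMod p) := fun h => hcen (hcx.2 h.symm)
        rw [if_pos ⟨hodd, hcen⟩, if_pos (mem_erase.2 ⟨hne, mem_univ _⟩)]
        have hB : ¬ (p : ℤ) ∣ (b 0 - 2 * x) := by
          intro hd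
          refine hcen ?_
          unfold CentreIn
          have h' := dvd_neg.2 hd
          rwa [neg_sub] at h'
        have hBq : ((b 0 : ℚ) - 2 * x) ≠ 0 := by
          have : (b 0 - 2 * x : ℤ) ≠ 0 := fun h0 => hB (by rw [h0]; exact dvd_zero _)
          exact_mod_cast this
        have hBz : (((b 0 - 2 * x : ℤ)) : ZMod p) ≠ 0 := by
          rwa [Ne, ZMod.intCast_zmod_eq_zero_iff_dvd]
        rw [show (1 : ℚ) / ((b 0 : ℚ) / 2 - x) = ((2 : ℤ) : ℚ) * (((b 0 - 2 * x : ℤ) : ℚ)) ^ (-1 : ℤ) by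
          rw [zpow_neg_one]; push_cast; field_simp,
          PInt.cast_mul (PInt.intCast _) (PInt.zpow_int hB _), Rat.cast_intCast, PInt.cast_zpow_int hB, zpow_neg_one]
        have hcx' : c - (x : ZMod p) ≠ 0 := sub_ne_zero.2 hne
        rw [hc] at hcx' ⊢
        push_cast at hBz ⊢
        field_simp
    · rw [if_neg (fun h => hodd h.1), Rat.cast_zero]
      refine (Finset.sum_eq_zero fun w _ => ?_).symm
      rw [if_neg (fun h => hodd h.1), Int.cast_zero, zero_mul]
  -- assemble
  refine ⟨by unfold phiHat; exact PInt.add hdenS hBden, ?_⟩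
  unfold phiHat
  rw [PInt.cast_add hdenS hBden, hcastS, hfib, hBcast, ← sum_add_distrib]
  refine sum_congr rfl fun w _ => ?_
  unfold classExp
  push_cast
  ring

/-- **`phiBar` is `φ` modulo `p`**: for a residue `x < p`, `phiBar b p x = (φ_x : ZMod p)`. -/
theorem phiBar_eq_cast_phiHat (b : ℕ → ℤ) (hp5 : 5 ≤ p) {x : ℕ} (hx : x < p) :
    phiBar b p x = ((phiHat b p x : ℚ) : ZMod p) := by
  classical
  rw [(cast_phiHat b hp5 x).2]
  unfold phiBar
  rw [Nat.mod_eq_of_lt hx]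
  have hcong : ∀ y ∈ (range p).erase x, ((classExp b p y : ℤ) : ZMod p) * (((y : ℕ) : ZMod p) - (x : ZMod p))⁻¹
      = (fun w : ZMod p => ((classExp b p w.val : ℤ) : ZMod p) * (w - (x : ZMod p))⁻¹) ((y : ℕ) : ZMod p) := by
    intro y hy
    simp only [ZMod.val_cast_of_lt (mem_range.1 (mem_of_mem_erase hy))]
  rw [Finset.sum_congr rfl hcong]
  exact sum_range_erase_eq_sum_univ_erase
    (fun w : ZMod p => ((classExp b p w.val : ℤ) : ZMod p) * (w - (x : ZMod p))⁻¹) hx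

/-! ## §2 The rational residue sum is `≡ 0 (mod p)` -/

/-- **`‖Res₀(c)‖ ≤ p⁻¹`.**  On the polytope, with pole classes of exponent `≥ −M` and `p(M−2) + Σ_x E_x(c) ≤ −2`, the rational residue sum
`Σ_{pole, E=−M} ĝφ + Σ_{pole, E=−M+1} ĝ` has norm `≤ p⁻¹` (it is `p`-integral with image `0` by `residueIdentityB_holds`). -/
theorem res0_padicNorm_le (c : ℕ → ℤ) (M : ℕ) (hc : InPolytope c) (hp5 : 5 ≤ p) (hpc : (p : ℤ) ≤ c 0) (hM : 2 ≤ M)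
    (G1 : ∀ x, x < p → 1 ≤ classPoleCount c p x → -(M : ℤ) ≤ classExp c p x)
    (hdeg : (p : ℤ) * ((M : ℤ) - 2) + ∑ x ∈ range p, classExp c p x ≤ -2) :
    padicNorm p
      ((∑ z ∈ (range p).filter (fun x => 1 ≤ classPoleCount c p x ∧ classExp c p x = -(M : ℤ)), gHat c p z * phiHat c p z)
        + ∑ z ∈ (range p).filter (fun x => 1 ≤ classPoleCount c p x ∧ classExp c p x = -(M : ℤ) + 1), gHat c p z)
      ≤ (p : ℚ) ^ (-(1 : ℤ)) := by
  classical
  have hd1 : ∀ z ∈ (range p).filter (fun x => 1 ≤ classPoleCount c p x ∧ classExp c p x = -(M : ℤ)),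
      ¬ p ∣ (gHat c p z * phiHat c p z).den := fun z _ => PInt.mul (cast_gHat c hp5 z).1 (cast_phiHat c hp5 z).1
  have hd2 : ∀ z ∈ (range p).filter (fun x => 1 ≤ classPoleCount c p x ∧ classExp c p x = -(M : ℤ) + 1),
      ¬ p ∣ (gHat c p z).den := fun z _ => (cast_gHat c hp5 z).1
  have hden := PInt.add (PInt.sum hd1) (PInt.sum hd2)
  rw [← PInt.cast_eq_zero_iff_norm hden, PInt.cast_add (PInt.sum hd1) (PInt.sum hd2), PInt.cast_sum hd1, PInt.cast_sum hd2]
  have h1 : ∀ z ∈ (range p).filter (fun x => 1 ≤ classPoleCount c p x ∧ classExp c p x = -(M : ℤ)),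
      ((gHat c p z * phiHat c p z : ℚ) : ZMod p) = gBar c p z * phiBar c p z := by
    intro z hz
    have hzp := mem_range.1 (mem_filter.1 hz).1
    rw [PInt.cast_mul (cast_gHat c hp5 z).1 (cast_phiHat c hp5 z).1, gBar_eq_cast_gHat c hp5 hzp,
      phiBar_eq_cast_phiHat c hp5 hzp]
  have h2 : ∀ z ∈ (range p).filter (fun x => 1 ≤ classPoleCount c p x ∧ classExp c p x = -(M : ℤ) + 1),
      ((gHat c p z : ℚ) : ZMod p) = gBar c p z := by
    intro z hz
    rw [gBar_eq_cast_gHat c hp5 (mem_range.1 (mem_filter.1 hz).1)]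
  rw [sum_congr rfl h1, sum_congr rfl h2]
  -- a class of negative exponent has a pole, so the pole condition in the filters is redundant
  have hfilt : ∀ e : ℤ, e < 0 → (range p).filter (fun x => 1 ≤ classPoleCount c p x ∧ classExp c p x = e)
      = (range p).filter (fun x => classExp c p x = e) := by
    intro e he
    refine filter_congr fun x _ => ⟨fun h => h.2, fun h => ⟨?_, h⟩⟩
    by_contra h0
    have := classExp_nonneg_of_classPoleCount_eq_zero c p x (by omega)
    omega
  rw [hfilt _ (by omega), hfilt _ (by omega)]
  exact (residueIdentityB_holds c p M hc hp.out hp5 hpc hM G1).1 hdeg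

/-! ## §3 The glue: `TypeSpaceLawZero` by name -/

/-- `Σ_{x<p} E_x(c) = −(2d(c) + 5)` on the polytope (`sum_classExp_val`, reindexed to `range p`). -/
theorem sum_classExp_range (c : ℕ → ℤ) (hc : InPolytope c) (hp5 : 5 ≤ p) :
    ∑ x ∈ range p, classExp c p x = -(2 * dOf c + 5) := by
  rw [sum_range_eq_sum_univ_val]
  exact sum_classExp_val c hp5 hc.1.1 (fun j hj => ⟨(hc.1.2 j hj).1, hc.2.1 j hj⟩)

/-- **THE TYPE-SPACE LAW, ZERO REGIME, IS A THEOREM** (`ResidueLaw.TypeSpaceLawZero`, gen-2 g11 REPORT §4 THEOREM W (Z)):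
`v_p(Cas_j(b)) ≥ 6 − 2M = casLB + 3`. -/
theorem typeSpaceLawZero_holds : TypeSpaceLawZero := by
  intro b p j M hb hb' hj1 hj7 hprime hp5 hpb hwin hM hMe G1 G3 hdeg HA hcas
  haveI : Fact p.Prime := ⟨hprime⟩
  have hdegb : (p : ℤ) * ((M : ℤ) - 2) + ∑ x ∈ range p, classExp b p x ≤ -2 := by omega
  have hsum : ∑ x ∈ range p, classExp (shift b j) p x = ∑ x ∈ range p, classExp b p x + 2 := by
    rw [sum_classExp_range (shift b j) hb' hp5, sum_classExp_range b hb hp5, dOf_shift b hj1 hj7]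
    ring
  have hdeg' : (p : ℤ) * ((M : ℤ) - 2) + ∑ x ∈ range p, classExp (shift b j) p x ≤ -2 := by omega
  have hpb' : (p : ℤ) ≤ shift b j 0 := by rw [shift_zero b hj1]; exact hpb
  exact typeSpaceLawZero_of_residues b p j M hb hb' hj1 hj7 hprime hp5 hpb hwin hM hMe G1 G3 HA
    (res0_padicNorm_le b M hb hp5 hpb (by omega) G1 hdegb)
    (res0_padicNorm_le (shift b j) M hb' hp5 hpb' (by omega) (G1_shift b hb hj1 G1) hdeg') hcas

end Summit.KontsevichZagierPeriods.Zeta5Search.ResidueLaw
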